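import Mathlib
import Summits.Ventures.PercRepro2.Defs
import Summits.Ventures.PercRepro2.Independence
import Summits.Ventures.PercRepro2.Graph
import Summits.Ventures.PercRepro2.Induced

/-!
# The hull of a vertex in a two-colouring (blind cell PercRepro2, typer-1; lead g10
`LEAD-PROOFSHAPES.md` ADDENDUM 24 (0)–(1), ask 2026-08-23T06:35:39Z)

A configuration `ζ : Config E` is read as a two-colouring: `ζ e = true` is RED (copy 1), the
complementary colouring `blue ζ` is BLUE (copy 2). For a vertex `l`:

* `cluster ends ζ l` = the red cluster `C_R(l)`, `cluster ends (blue ζ) l` = the blue cluster `C_B(l)`;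
* `hull` = `C_R(l) ∪ C_B(l)`, `core` = `C_R(l) ∩ C_B(l)`, the sides `rside` = `C_R ∖ C_B`,
  `bside` = `C_B ∖ C_R`, the side sign `sideSign` = `1[o ∈ R_side] − 1[o ∈ B_side]`;
* `piece ζ l o` = the connected component of `o` in the graph induced on `hull ∖ core` (the
  PIECES of ADDENDUM 24 (4)(a)), `flip P ζ` = the colouring with every edge touching `P` flipped,
  `NonCritRed ζ l P` = "`Red − P` still joins every core vertex to `l`";
* structure lemmas: no edge joins the two sides (ADDENDUM 24 (1)(i)), a piece lies in one side,
  pieces are closed under adjacency inside `hull ∖ core`, and the colour symmetry `ζ ↔ blue ζ`.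
-/

namespace Summit.Ventures.PercRepro2

namespace Hull

variable {V : Type*} {E : Type*}

/-! ## Colourings -/

/-- The complementary (blue) colouring. -/
def blue (ζ : Config E) : Config E := fun e => !ζ e

/-- Blue of blue is red. -/
@[simp] lemma blue_blue (ζ : Config E) : blue (blue ζ) = ζ := by
  funext e; simp [blue]

/-- `blue ζ e = !ζ e`. -/
lemma blue_apply (ζ : Config E) (e : E) : blue ζ e = !ζ e := rfl

/-- An edge is blue iff it is not red. -/
lemma blue_eq_true_iff {ζ : Config E} {e : E} : blue ζ e = true ↔ ζ e = false := by
  simp [blue]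

open scoped Classical in
/-- The edge-flip along a vertex set `P`: every edge touching `P` changes colour. -/
noncomputable def flip (ends : E → Sym2 V) (P : Set V) (ζ : Config E) : Config E :=
  fun e => if e ∈ touches ends P then !ζ e else ζ e

variable {ends : E → Sym2 V}

/-- The flip on an edge touching `P`. -/
lemma flip_apply_of_mem {P : Set V} {ζ : Config E} {e : E} (h : e ∈ touches ends P) :
    flip ends P ζ e = !ζ e := by
  simp [flip, h]

/-- The flip on an edge not touching `P`. -/
lemma flip_apply_of_notMem {P : Set V} {ζ : Config E} {e : E} (h : e ∉ touches ends P) :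
    flip ends P ζ e = ζ e := by
  simp [flip, h]

/-- The flip is an involution. -/
@[simp] lemma flip_flip (P : Set V) (ζ : Config E) : flip ends P (flip ends P ζ) = ζ := by
  funext e
  by_cases h : e ∈ touches ends P
  · simp [flip, h]
  · simp [flip, h]

/-- The flip commutes with the colour swap. -/
lemma blue_flip (P : Set V) (ζ : Config E) : blue (flip ends P ζ) = flip ends P (blue ζ) := by
  funext e
  by_cases h : e ∈ touches ends P
  · simp [flip, blue, h]
  · simp [flip, blue, h]

/-- `delConfig` (delete the edges touching `P`) is below the flip. -/
lemma delConfig_le_flip (P : Set V) (ζ : Config E) : delConfig ends P ζ ≤ flip ends P ζ := by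
  intro e
  by_cases h : e ∈ touches ends P
  · rw [delConfig_apply_of_mem h]
    exact Bool.false_le _
  · rw [delConfig_apply_of_notMem h, flip_apply_of_notMem h]

/-- `delConfig` of the blue flip is `delConfig` of blue. -/
lemma delConfig_blue_flip (P : Set V) (ζ : Config E) :
    delConfig ends P (blue (flip ends P ζ)) = delConfig ends P (blue ζ) := by
  funext e
  by_cases h : e ∈ touches ends P
  · rw [delConfig_apply_of_mem h, delConfig_apply_of_mem h]
  · rw [delConfig_apply_of_notMem h, delConfig_apply_of_notMem h, blue_flip,
      flip_apply_of_notMem h]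

/-! ## Edges and touching -/

/-- Touching, read off the endpoints. -/
lemma mem_touches_iff_of_ends {S : Set V} {e : E} {x y : V} (h : ends e = s(x, y)) :
    e ∈ touches ends S ↔ x ∈ S ∨ y ∈ S := by
  constructor
  · rintro ⟨x', hx', y', h'⟩
    rw [h, Sym2.eq_iff] at h'
    rcases h' with ⟨rfl, rfl⟩ | ⟨rfl, rfl⟩
    · exact Or.inl hx'
    · exact Or.inr hx'
  · exact mem_touches_of_ends h

/-- Unpack an open adjacency. -/
lemma exists_edge_of_adj {ω : Config E} {x y : V} (h : (openGraph ends ω).Adj x y) :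
    x ≠ y ∧ ∃ e, ω e = true ∧ ends e = s(x, y) :=
  openGraph_adj.1 h

/-- Build an open adjacency. -/
lemma adj_of_edge {ω : Config E} {x y : V} {e : E} (hne : x ≠ y) (he : ω e = true)
    (hends : ends e = s(x, y)) : (openGraph ends ω).Adj x y :=
  openGraph_adj.2 ⟨hne, e, he, hends⟩

/-- Cluster membership propagates along an open edge. -/
lemma mem_cluster_of_edge {ω : Config E} {v x y : V} {e : E} (hx : x ∈ cluster ends ω v)
    (he : ω e = true) (hends : ends e = s(x, y)) : y ∈ cluster ends ω v := by
  by_cases hne : x = y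
  · exact hne ▸ hx
  · exact mem_cluster_of_adj hx (adj_of_edge hne he hends)

/-- The swapped endpoints. -/
lemma ends_swap {e : E} {x y : V} (h : ends e = s(x, y)) : ends e = s(y, x) := by
  rw [h, Sym2.eq_swap]

/-! ## Hull, core, sides, pieces -/

/-- The hull `H_l = C_R(l) ∪ C_B(l)`. -/
def hull (ends : E → Sym2 V) (ζ : Config E) (l : V) : Set V :=
  cluster ends ζ l ∪ cluster ends (blue ζ) l

/-- The core `K = C_R(l) ∩ C_B(l)`. -/
def core (ends : E → Sym2 V) (ζ : Config E) (l : V) : Set V :=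
  cluster ends ζ l ∩ cluster ends (blue ζ) l

/-- The red side `C_R(l) ∖ C_B(l)`. -/
def rside (ends : E → Sym2 V) (ζ : Config E) (l : V) : Set V :=
  cluster ends ζ l \ cluster ends (blue ζ) l

/-- The blue side `C_B(l) ∖ C_R(l)`. -/
def bside (ends : E → Sym2 V) (ζ : Config E) (l : V) : Set V :=
  cluster ends (blue ζ) l \ cluster ends ζ l

open scoped Classical in
/-- The side sign `s_{o,l} = 1[o ∈ R_side] − 1[o ∈ B_side]`. -/
noncomputable def sideSign (R : Type*) [Ring R] (ends : E → Sym2 V) (ζ : Config E) (l o : V) :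
    R :=
  (if o ∈ rside ends ζ l then 1 else 0) - (if o ∈ bside ends ζ l then 1 else 0)

open scoped Classical in
/-- The all-open configuration on the edges inside `hull ∖ core`. -/
noncomputable def freeConfig (ends : E → Sym2 V) (ζ : Config E) (l : V) : Config E :=
  fun e => decide (e ∈ within ends (hull ends ζ l \ core ends ζ l))

/-- The piece of `o`: its component in the graph induced on `hull ∖ core`. -/
noncomputable def piece (ends : E → Sym2 V) (ζ : Config E) (l o : V) : Set V :=
  cluster ends (freeConfig ends ζ l) o

/-- `P` is non-critical for the red colouring: deleting the edges touching `P` keeps every core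
vertex red-connected to `l`. -/
def NonCritRed (ends : E → Sym2 V) (ζ : Config E) (l : V) (P : Set V) : Prop :=
  ∀ k ∈ core ends ζ l, Conn ends (delConfig ends P ζ) l k

/-! ## Colour symmetry -/

/-- The hull is colour-symmetric. -/
lemma hull_blue (ζ : Config E) (l : V) : hull ends (blue ζ) l = hull ends ζ l := by
  simp only [hull, blue_blue]; exact Set.union_comm _ _

/-- The core is colour-symmetric. -/
lemma core_blue (ζ : Config E) (l : V) : core ends (blue ζ) l = core ends ζ l := by
  simp only [core, blue_blue]; exact Set.inter_comm _ _

/-- The red side of the blue colouring is the blue side. -/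
lemma rside_blue (ζ : Config E) (l : V) : rside ends (blue ζ) l = bside ends ζ l := by
  simp only [rside, bside, blue_blue]

/-- The blue side of the blue colouring is the red side. -/
lemma bside_blue (ζ : Config E) (l : V) : bside ends (blue ζ) l = rside ends ζ l := by
  simp only [rside, bside, blue_blue]

/-- The free configuration is colour-symmetric. -/
lemma freeConfig_blue (ζ : Config E) (l : V) : freeConfig ends (blue ζ) l = freeConfig ends ζ l := by
  unfold freeConfig
  rw [hull_blue, core_blue]

/-- The pieces are colour-symmetric. -/
lemma piece_blue (ζ : Config E) (l o : V) : piece ends (blue ζ) l o = piece ends ζ l o := by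
  simp only [piece, freeConfig_blue]

/-! ## Elementary structure -/

/-- Membership in the core. -/
lemma mem_core_iff {ζ : Config E} {l x : V} :
    x ∈ core ends ζ l ↔ x ∈ cluster ends ζ l ∧ x ∈ cluster ends (blue ζ) l := Iff.rfl

/-- Membership in the red side. -/
lemma mem_rside_iff {ζ : Config E} {l x : V} :
    x ∈ rside ends ζ l ↔ x ∈ cluster ends ζ l ∧ x ∉ cluster ends (blue ζ) l := Iff.rfl

/-- Membership in the blue side. -/
lemma mem_bside_iff {ζ : Config E} {l x : V} :
    x ∈ bside ends ζ l ↔ x ∈ cluster ends (blue ζ) l ∧ x ∉ cluster ends ζ l := Iff.rfl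

/-- Membership in the hull. -/
lemma mem_hull_iff {ζ : Config E} {l x : V} :
    x ∈ hull ends ζ l ↔ x ∈ cluster ends ζ l ∨ x ∈ cluster ends (blue ζ) l := Iff.rfl

/-- `l` lies in its core. -/
lemma l_mem_core (ζ : Config E) (l : V) : l ∈ core ends ζ l :=
  ⟨mem_cluster_self _ _ _, mem_cluster_self _ _ _⟩

/-- The red side lies in `hull ∖ core`. -/
lemma rside_subset_hull_sdiff_core (ζ : Config E) (l : V) :
    rside ends ζ l ⊆ hull ends ζ l \ core ends ζ l :=
  fun _ ⟨h₁, h₂⟩ => ⟨Or.inl h₁, fun h => h₂ h.2⟩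

/-- The blue side lies in `hull ∖ core`. -/
lemma bside_subset_hull_sdiff_core (ζ : Config E) (l : V) :
    bside ends ζ l ⊆ hull ends ζ l \ core ends ζ l :=
  fun _ ⟨h₁, h₂⟩ => ⟨Or.inr h₁, fun h => h₂ h.1⟩

/-- `hull ∖ core` is the union of the two sides. -/
lemma mem_rside_or_bside_of_mem_hull_sdiff_core {ζ : Config E} {l x : V}
    (h : x ∈ hull ends ζ l \ core ends ζ l) : x ∈ rside ends ζ l ∨ x ∈ bside ends ζ l := by
  rcases h with ⟨hR | hB, hK⟩
  · exact Or.inl ⟨hR, fun hB => hK ⟨hR, hB⟩⟩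
  · exact Or.inr ⟨hB, fun hR => hK ⟨hR, hB⟩⟩

/-- The two sides are disjoint. -/
lemma rside_disjoint_bside (ζ : Config E) (l : V) (x : V) (hR : x ∈ rside ends ζ l)
    (hB : x ∈ bside ends ζ l) : False :=
  hR.2 hB.1

/-- **ADDENDUM 24 (1)(i)**: no edge joins the red side to the blue side. -/
lemma no_edge_rside_bside {ζ : Config E} {l x y : V} {e : E} (hx : x ∈ rside ends ζ l)
    (hy : y ∈ bside ends ζ l) (hends : ends e = s(x, y)) : False := by
  cases he : ζ e with
  | true => exact hy.2 (mem_cluster_of_edge hx.1 he hends)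
  | false =>
    exact hx.2 (mem_cluster_of_edge hy.1 (blue_eq_true_iff.2 he) (ends_swap hends))

/-- An edge from a red-side vertex into the hull minus the core ends on the red side. -/
lemma mem_rside_of_edge {ζ : Config E} {l x y : V} {e : E} (hx : x ∈ rside ends ζ l)
    (hy : y ∈ hull ends ζ l \ core ends ζ l) (hends : ends e = s(x, y)) : y ∈ rside ends ζ l := by
  rcases mem_rside_or_bside_of_mem_hull_sdiff_core hy with h | h
  · exact h
  · exact absurd hends (fun hends => no_edge_rside_bside hx h hends)

/-! ## Pieces -/

/-- `o` lies in its piece. -/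
lemma mem_piece_self (ζ : Config E) (l o : V) : o ∈ piece ends ζ l o :=
  mem_cluster_self _ _ _

/-- The free configuration is open exactly on the edges inside `hull ∖ core`. -/
lemma freeConfig_eq_true_iff {ζ : Config E} {l : V} {e : E} :
    freeConfig ends ζ l e = true ↔ e ∈ within ends (hull ends ζ l \ core ends ζ l) := by
  simp [freeConfig]

/-- A piece of a vertex of `hull ∖ core` lies in `hull ∖ core`. -/
lemma piece_subset {ζ : Config E} {l o : V} (ho : o ∈ hull ends ζ l \ core ends ζ l) :
    piece ends ζ l o ⊆ hull ends ζ l \ core ends ζ l := by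
  intro x hx
  refine mem_of_conn_of_closed (ends := ends) (ω := freeConfig ends ζ l) ?_ ho hx
  intro a _ b hab
  obtain ⟨_, e, he, hends⟩ := exists_edge_of_adj hab
  obtain ⟨x', hx', y', hy', h'⟩ := freeConfig_eq_true_iff.1 he
  rw [hends, Sym2.eq_iff] at h'
  rcases h' with ⟨rfl, rfl⟩ | ⟨rfl, rfl⟩
  · exact hy'
  · exact hx'

/-- Pieces are closed under adjacency inside `hull ∖ core`. -/
lemma mem_piece_of_edge {ζ : Config E} {l o x y : V} {e : E}
    (hxP : x ∈ piece ends ζ l o) (hxH : x ∈ hull ends ζ l \ core ends ζ l)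
    (hy : y ∈ hull ends ζ l \ core ends ζ l) (hends : ends e = s(x, y)) : y ∈ piece ends ζ l o := by
  have he : freeConfig ends ζ l e = true := freeConfig_eq_true_iff.2 ⟨x, hxH, y, hy, hends⟩
  exact mem_cluster_of_edge hxP he hends

/-- A piece of a red-side vertex lies on the red side. -/
lemma piece_subset_rside {ζ : Config E} {l o : V} (ho : o ∈ rside ends ζ l) :
    piece ends ζ l o ⊆ rside ends ζ l := by
  intro x hx
  refine mem_of_conn_of_closed (ends := ends) (ω := freeConfig ends ζ l) ?_ ho hx
  intro a ha b hab
  obtain ⟨_, e, he, hends⟩ := exists_edge_of_adj hab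
  obtain ⟨x', hx', y', hy', h'⟩ := freeConfig_eq_true_iff.1 he
  rw [hends, Sym2.eq_iff] at h'
  rcases h' with ⟨rfl, rfl⟩ | ⟨rfl, rfl⟩
  · exact mem_rside_of_edge ha hy' hends
  · exact mem_rside_of_edge ha hx' hends

end Hull

end Summit.Ventures.PercRepro2
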